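import Literature.GroupTheory.CombinatorialGroupTheory.QuadraticSystems
import Mathlib.Data.Fintype.Card
import HarnessLib

/-!
# Peripheral systems of a one-vertex ribbon graph, I: the petal move

Topic `Literature/GroupTheory/CombinatorialGroupTheory`; continues `QuadraticSystems.lean`.
A finite connected graph with a rotation system (a ribbon graph) with ONE vertex is recorded, as
in `QuadraticSystems.lean`, by the system of its boundary cycles (faces): a list of words
`Fs : List (List (ι × Bool))` over the edge symbols `ι` using every letter `(i, ±)` exactly once
(`Fs.flatten.Nodup`, `∀ l, l ∈ Fs.flatten`), all faces nonempty, whose vertex permutation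
`sysPerm Fs` is transitive.  Its fundamental group is the free group `F(ι)` and the faces are its
PERIPHERAL elements (the boundary curves of the thickened surface `Σ_{g,B}`, `B = |Fs|`).  This
file and `PeripheralPetals.lean` perform the first half of the reduction of such a system to the
standard peripheral system `c₁, …, c_B`, `∏[aᵢ,bᵢ] c₁ ⋯ c_B = 1` of `π₁(Σ_{g,B})`
(Zieschang–Vogt–Coldewey LNM 835 §3.2 / Thm. 3.2.6 with boundary, §4.14; Hoare–Karrass–Solitar
1971 for the application to subgroups of finite index): by cut-and-paste moves every face except
the first becomes a PETAL — a single letter — while the first face absorbs all other letters.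
Here: the combinatorics of one move on the vertex permutation.

Main steps: `sysPerm_appendPetal_transitive` (adding a petal at a corner keeps one vertex),
`sysPerm_petalMove_transitive` (the move = glue two faces along an edge, `sysPerm_glue_transitive`,
then re-insert the edge as a petal), `exists_face_sharing_edge` (in a one-vertex system some
non-petal face shares an edge with the first face).  Theorems only.

## References

* H. Zieschang, E. Vogt, H.-D. Coldewey, *Surfaces and Planar Discontinuous Groups*, LNM 835,
  Springer 1980, §3.2 (3.2.4–3.2.6), §4.14. [ZieschangVogtColdewey1980]
* A. H. M. Hoare, A. Karrass, D. Solitar, *Subgroups of finite index of Fuchsian groups*,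
  Math. Z. 120 (1971) 289–298, Thm. 1. [HoareKarrassSolitar1971]
-/

namespace Literature.GroupTheory.CombinatorialGroupTheory

open List Equiv Equiv.Perm

variable {ι : Type*} [DecidableEq ι]

/-! ### Small facts about `sysPerm` -/

/-- A petal (one-letter face) in front does not change the vertex permutation.
[cite: ZieschangVogtColdewey1980, 3.1.2] -/
theorem sysPerm_singleton_cons (x : ι × Bool) (Gs : List (List (ι × Bool))) :
    sysPerm ([x] :: Gs) = sysPerm Gs := by
  simp [sysPerm, formPerm_singleton]

/-- Swapping the first two faces does not change the vertex permutation.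
[cite: ZieschangVogtColdewey1980, 3.1.2] -/
theorem sysPerm_swap (F G : List (ι × Bool)) (Gs : List (List (ι × Bool)))
    (hd : (F :: G :: Gs).flatten.Nodup) : sysPerm (F :: G :: Gs) = sysPerm (G :: F :: Gs) :=
  sysPerm_eq_of_perm hd (List.Perm.swap G F Gs)

/-- Rotating the second face does not change the vertex permutation.
[cite: ZieschangVogtColdewey1980, 3.1.2] -/
theorem sysPerm_cons_cons_eq_of_isRotated (F : List (ι × Bool)) {G G' : List (ι × Bool)}
    (Gs : List (List (ι × Bool))) (hd : (F :: G :: Gs).flatten.Nodup) (h : G ~r G') :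
    sysPerm (F :: G :: Gs) = sysPerm (F :: G' :: Gs) := by
  have hG : G.Nodup := (nodup_flatten.1 hd).1 G (by simp)
  have hd' : (G :: F :: Gs).flatten.Nodup := hd.perm (List.Perm.swap G F Gs).symm.flatten.symm
  have hd'' : (G' :: F :: Gs).flatten.Nodup := by
    refine hd'.perm ?_
    simp only [flatten_cons]
    exact h.perm.append_right _
  rw [sysPerm_swap F G Gs hd, sysPerm_cons_eq_of_isRotated (F :: Gs) hG h, ← sysPerm_swap F G' Gs]
  exact hd''.perm (List.Perm.swap F G' Gs).flatten

omit [DecidableEq ι] in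
/-- The letters of a system with a rotated face. [cite: ZieschangVogtColdewey1980, 3.1.1] -/
theorem mem_flatten_cons_iff_of_isRotated {F F' : List (ι × Bool)} (Gs : List (List (ι × Bool)))
    (h : F ~r F') (l : ι × Bool) : l ∈ (F :: Gs).flatten ↔ l ∈ (F' :: Gs).flatten := by
  simp only [flatten_cons, mem_append, h.perm.mem_iff]

/-! ### Adding a petal -/

/-- **Adding a petal at a corner keeps one vertex.**  If the system `A :: Gs` (with `A ≠ []`,
pairwise distinct letters containing the partner of the last letter of `A`) has one vertex on its
letters and `x`, `x̄` are fresh letters, then so does the system `(A ++ [x̄]) :: [x] :: Gs`: the new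
edge `x` is a loop at the vertex bounding a monogon.  (The vertex permutation becomes
`σ * swap ā x`, `a` the last letter of `A`, which merges the cycle of `ā` with the fresh 2-cycle
`{x, x̄}`.) [cite: ZieschangVogtColdewey1980, 3.1.6] -/
theorem sysPerm_appendPetal_transitive [Fintype ι] {A : List (ι × Bool)} {Gs : List (List (ι × Bool))}
    {x : ι × Bool} (hA : A ≠ []) (hd : ((A ++ [bar x]) :: [x] :: Gs).flatten.Nodup)
    (hlast : bar (A.getLast hA) ∈ (A :: Gs).flatten)
    (h : ∀ y ∈ (A :: Gs).flatten, ∀ z ∈ (A :: Gs).flatten, (sysPerm (A :: Gs)).SameCycle y z) :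
    ∀ y ∈ ((A ++ [bar x]) :: [x] :: Gs).flatten, ∀ z ∈ ((A ++ [bar x]) :: [x] :: Gs).flatten,
      (sysPerm ((A ++ [bar x]) :: [x] :: Gs)).SameCycle y z := by
  classical
  -- letters
  have hx : x ∉ (A :: Gs).flatten := by
    intro hx'
    simp only [flatten_cons, mem_append] at hx'
    have hnd := hd
    simp only [flatten_cons] at hnd
    rcases hx' with hx' | hx'
    · exact (disjoint_of_nodup_append hnd) (mem_append_left _ hx') (mem_append_left _ (mem_singleton_self x))
    · have h2 := (nodup_append.1 hnd).2.1
      exact (disjoint_of_nodup_append h2) (mem_singleton_self x) hx'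
  have hx' : bar x ∉ (A :: Gs).flatten := by
    intro hx''
    simp only [flatten_cons, mem_append] at hx''
    have hnd := hd
    simp only [flatten_cons] at hnd
    rcases hx'' with h1 | h1
    · have h2 := (nodup_append.1 hnd).1
      exact (disjoint_of_nodup_append h2) h1 (mem_singleton_self _)
    · exact (disjoint_of_nodup_append hnd) (mem_append_right _ (mem_singleton_self _))
        (mem_append_right _ h1)
  -- the vertex permutations
  have hd₁ : (A :: [bar x] :: [x] :: Gs).flatten.Nodup := by simpa [flatten_cons] using hd
  set σ := sysPerm (A :: Gs) with hσ
  have hmid : sysPerm (A :: [bar x] :: [x] :: Gs) = σ := by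
    simp [hσ, sysPerm, formPerm_singleton]
  have hnew : sysPerm ((A ++ [bar x]) :: [x] :: Gs) = σ * swap (bar (A.getLast hA)) x := by
    rw [sysPerm_append_cons (Gs := [x] :: Gs) hd₁ hA (cons_ne_nil _ _), hmid]
    simp
  -- `σ` on the fresh letters: a 2-cycle
  have hσx : σ x = bar x := by
    rw [hσ, sysPerm_apply, prod_formPerm_apply_of_not_mem hx']
  have hσx' : σ (bar x) = x := by
    rw [hσ, sysPerm_apply, bar_bar, prod_formPerm_apply_of_not_mem hx]
  -- the `σ`-cycle of `x` is `{x, x̄}`, which misses `ā`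
  have hcyc : ∀ y, σ.SameCycle x y → y = x ∨ y = bar x := by
    intro y hy
    have hT : ∀ z ∈ ({x, bar x} : Set (ι × Bool)), σ z ∈ ({x, bar x} : Set (ι × Bool)) := by
      intro z hz
      rcases hz with rfl | hz
      · rw [hσx]; exact Or.inr rfl
      · rw [Set.mem_singleton_iff] at hz; subst hz; rw [hσx']; exact Or.inl rfl
    exact SameCycle.mem_of_forall_apply_mem hT (Or.inl rfl) hy
  have haA : A.getLast hA ∈ A := getLast_mem hA
  have hnot : ¬ σ.SameCycle (bar (A.getLast hA)) x := by
    intro hs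
    rcases hcyc _ hs.symm with e | e
    · -- `x = ā`, i.e. `x̄ = a ∈ A`: impossible
      have : bar x ∈ (A :: Gs).flatten := by
        rw [flatten_cons]; refine mem_append_left _ ?_
        rw [← e, bar_bar]; exact haA
      exact hx' this
    · -- `x̄ = ā`, i.e. `x = a ∈ A`
      have : x ∈ (A :: Gs).flatten := by
        rw [flatten_cons]; refine mem_append_left _ ?_
        rw [← bar_injective e]; exact haA
      exact hx this
  -- merge
  set u := bar (A.getLast hA) with hu
  have hτu : (σ * swap u x) u = σ x := by rw [Perm.mul_apply, swap_apply_left]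
  have hτx : (σ * swap u x) x = σ u := by rw [Perm.mul_apply, swap_apply_right]
  have hτ : ∀ z, z ≠ u → z ≠ x → (σ * swap u x) z = σ z := fun z h1 h2 => by
    rw [Perm.mul_apply, swap_apply_of_ne_of_ne h1 h2]
  have merge : ∀ y, y ∈ ((A ++ [bar x]) :: [x] :: Gs).flatten → (σ * swap u x).SameCycle u y := by
    intro y hy
    refine sameCycle_of_swap_merge hτu hτx hτ hnot ?_
    have hy' : y ∈ (A :: Gs).flatten ∨ y = bar x ∨ y = x := by
      simp only [flatten_cons, mem_append, mem_singleton] at hy ⊢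
      tauto
    rcases hy' with hy' | rfl | rfl
    · exact Or.inl (h u hlast y hy')
    · exact Or.inr ⟨1, by rw [zpow_one, hσx]⟩
    · exact Or.inr SameCycle.rfl
  intro y hy z hz
  rw [hnew]
  exact (merge y hy).symm.trans (merge z hz)


/-! ### The petal move -/

omit [DecidableEq ι] in
/-- The letters of the petal move are a rearrangement. [cite: ZieschangVogtColdewey1980, 3.2.4] -/
theorem perm_flatten_petalMove {A C R : List (ι × Bool)} (Gs : List (List (ι × Bool))) (x : ι × Bool)
    (hR : (A ++ C) ~r R) :
    ((R ++ [bar x]) :: [x] :: Gs).flatten ~ ((A ++ [x]) :: (C ++ [bar x]) :: Gs).flatten := by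
  simp only [flatten_cons, append_assoc, cons_append]
  refine Perm.trans (Perm.append_right _ hR.perm.symm) ?_
  simp only [append_assoc]
  refine Perm.append_left A ?_
  -- `C ++ x̄ :: x :: rest ~ x :: (C ++ x̄ :: rest)`
  calc C ++ (bar x :: x :: Gs.flatten)
      ~ C ++ (x :: bar x :: Gs.flatten) := Perm.append_left C (Perm.swap _ _ _)
    _ ~ x :: (C ++ bar x :: Gs.flatten) := perm_middle

/-- **The petal move keeps one vertex.**  In a complete system with pairwise distinct letters and
one vertex, replace the faces `A x` and `C x̄` by the face `R x̄`, `R` any rotation of `A C`, and the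
petal `x` (cut the two faces open along `x`, glue, and re-insert `x` as a loop): the result is
again complete with pairwise distinct letters and one vertex.  Requires `A C ≠ []`.
[cite: ZieschangVogtColdewey1980, 3.2.4] -/
theorem sysPerm_petalMove_transitive [Fintype ι] {A C R : List (ι × Bool)}
    {Gs : List (List (ι × Bool))} {x : ι × Bool}
    (hd : ((A ++ [x]) :: (C ++ [bar x]) :: Gs).flatten.Nodup)
    (hall : ∀ l, l ∈ ((A ++ [x]) :: (C ++ [bar x]) :: Gs).flatten)
    (h : ∀ y z, (sysPerm ((A ++ [x]) :: (C ++ [bar x]) :: Gs)).SameCycle y z)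
    (hAC : A ++ C ≠ []) (hR : (A ++ C) ~r R) :
    ((R ++ [bar x]) :: [x] :: Gs).flatten.Nodup ∧
    (∀ l, l ∈ ((R ++ [bar x]) :: [x] :: Gs).flatten) ∧
    ∀ y z, (sysPerm ((R ++ [bar x]) :: [x] :: Gs)).SameCycle y z := by
  classical
  have hperm := perm_flatten_petalMove Gs x hR
  have hd' : ((R ++ [bar x]) :: [x] :: Gs).flatten.Nodup := (hperm.nodup_iff).2 hd
  have hall' : ∀ l, l ∈ ((R ++ [bar x]) :: [x] :: Gs).flatten := fun l => hperm.mem_iff.2 (hall l)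
  refine ⟨hd', hall', ?_⟩
  -- glue along `x`
  have hglue := sysPerm_glue_transitive (y := x) (A := A) (C := C) (Gs := Gs) hd
    (fun y _ z _ => h y z)
  -- rotate the glued face to `R`
  have hdAC : ((A ++ C) :: Gs).flatten.Nodup := by
    have : ((A ++ C) :: Gs).flatten.Sublist (((A ++ [x]) :: (C ++ [bar x]) :: Gs).flatten) := by
      simp only [flatten_cons, ← append_assoc]
      refine Sublist.append_right ?_ _
      refine Sublist.trans (Sublist.append_right (sublist_append_left A [x]) C) ?_
      exact sublist_append_left _ _
    exact hd.sublist this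
  have hACn : (A ++ C).Nodup := (nodup_flatten.1 hdAC).1 _ (by simp)
  have hR' : R ≠ [] := fun e => hAC (by
    rw [e] at hR; exact List.Perm.eq_nil hR.perm)
  have hrot : sysPerm ((A ++ C) :: Gs) = sysPerm (R :: Gs) := sysPerm_cons_eq_of_isRotated Gs hACn hR
  have hmemR : ∀ l, l ∈ (R :: Gs).flatten ↔ l ∈ ((A ++ C) :: Gs).flatten := fun l =>
    (mem_flatten_cons_iff_of_isRotated Gs hR l).symm
  have hR1 : ∀ y ∈ (R :: Gs).flatten, ∀ z ∈ (R :: Gs).flatten, (sysPerm (R :: Gs)).SameCycle y z := by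
    intro y hy z hz
    rw [← hrot]
    exact hglue y ((hmemR y).1 hy) z ((hmemR z).1 hz)
  -- the partner of the last letter of `R` is an old letter other than `x`, `x̄`
  have hd₀ := hd
  simp only [flatten_cons] at hd₀
  have hdisj := disjoint_of_nodup_append hd₀
  have hAx : (A ++ [x]).Nodup := (nodup_append.1 hd₀).1
  have hCx : (C ++ [bar x]).Nodup := (nodup_append.1 (nodup_append.1 hd₀).2.1).1
  have hxR : x ∉ R := fun hx => by
    rcases mem_append.1 (hR.perm.mem_iff.2 hx) with hx' | hx'
    · exact (disjoint_of_nodup_append hAx) hx' (mem_singleton_self x)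
    · exact hdisj (mem_append_right A (mem_singleton_self x))
        (mem_append_left _ (mem_append_left _ hx'))
  have hxR' : bar x ∉ R := fun hx => by
    rcases mem_append.1 (hR.perm.mem_iff.2 hx) with hx' | hx'
    · exact hdisj (mem_append_left _ hx')
        (mem_append_left _ (mem_append_right C (mem_singleton_self _)))
    · exact (disjoint_of_nodup_append hCx) hx' (mem_singleton_self _)
  have hlast : bar (R.getLast hR') ∈ (R :: Gs).flatten := by
    have hmem := hall' (bar (R.getLast hR'))
    simp only [flatten_cons, mem_append, mem_singleton] at hmem ⊢
    rcases hmem with (hmem | hmem) | hmem | hmem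
    · exact Or.inl hmem
    · exact absurd (getLast_mem hR') (by rw [← bar_bar (R.getLast hR'), hmem, bar_bar]; exact hxR)
    · exact absurd (getLast_mem hR') (by rw [← bar_bar (R.getLast hR'), hmem]; exact hxR')
    · exact Or.inr hmem
  have key := sysPerm_appendPetal_transitive hR' hd' hlast hR1
  intro y z
  exact key y (hall' y) z (hall' z)

/-! ### A face sharing an edge with the first face -/

/-- **In a one-vertex system some long face shares an edge with the first face.**  If the system
`W :: Rs` is complete with pairwise distinct letters, one vertex, `W ≠ []`, and some face of `Rs`
is not a petal (has length `≠ 1`) and all faces are nonempty, then some non-petal face of `Rs`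
contains a letter whose partner lies in `W`.  (Otherwise the letters of `W` and their partners
would form a proper stable set of the vertex permutation.) [cite: ZieschangVogtColdewey1980, 3.1.6] -/
theorem exists_face_sharing_edge [Fintype ι] {W : List (ι × Bool)} {Rs : List (List (ι × Bool))}
    (hd : (W :: Rs).flatten.Nodup) (hall : ∀ l, l ∈ (W :: Rs).flatten) (hW : W ≠ [])
    (hne : ∀ F ∈ Rs, F ≠ []) (h1 : ∀ y z, (sysPerm (W :: Rs)).SameCycle y z)
    (hex : ∃ G ∈ Rs, G.length ≠ 1) :
    ∃ G ∈ Rs, G.length ≠ 1 ∧ ∃ x ∈ G, bar x ∈ W := by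
  classical
  by_contra H
  simp only [not_exists, not_and] at H
  -- the stable set
  set T : Set (ι × Bool) := {l | l ∈ W ∨ bar l ∈ W} with hT
  have hWmem : W ∈ W :: Rs := mem_cons_self
  have hstab : ∀ l ∈ T, sysPerm (W :: Rs) l ∈ T := by
    intro l hl
    -- locate the face of `l̄`
    obtain ⟨F, hF, hlF⟩ := mem_flatten.1 (hall (bar l))
    rw [sysPerm_apply_of_bar_mem hd hF hlF]
    rcases mem_cons.1 hF with rfl | hF'
    · exact Or.inl (formPerm_apply_mem_of_mem hlF)
    · -- `l̄` lies in a face `F ∈ Rs`; then `l ∉ W̄`... examine `l ∈ T`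
      rcases hl with hl | hl
      · -- `l ∈ W`: `F` must be a petal `[l̄]`
        by_cases hlen : F.length = 1
        · obtain ⟨p, rfl⟩ : ∃ p, F = [p] := by
            match F, hlen with
            | [p], _ => exact ⟨p, rfl⟩
          rw [mem_singleton] at hlF
          subst hlF
          rw [formPerm_singleton, Perm.one_apply]
          exact Or.inr (by rw [bar_bar]; exact hl)
        · exact absurd hl (by have := H F hF' hlen (bar l) hlF; rwa [bar_bar] at this)
      · -- `l̄ ∈ W` and `l̄ ∈ F ∈ Rs`: impossible by disjointness
        exfalso
        rw [flatten_cons] at hd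
        exact (disjoint_of_nodup_append hd) hl (mem_flatten.2 ⟨F, hF', hlF⟩)
  obtain ⟨G, hG, hGlen⟩ := hex
  obtain ⟨g, hg⟩ := exists_mem_of_ne_nil G (hne G hG)
  obtain ⟨w, hw⟩ := exists_mem_of_ne_nil W hW
  have hgT : g ∈ T := SameCycle.mem_of_forall_apply_mem hstab (Or.inl hw : w ∈ T) (h1 w g)
  rcases hgT with hgW | hgW
  · rw [flatten_cons] at hd
    exact (disjoint_of_nodup_append hd) hgW (mem_flatten.2 ⟨G, hG, hg⟩)
  · exact H G hG hGlen g hg hgW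

end Literature.GroupTheory.CombinatorialGroupTheory
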